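import Literature.Topology.FourManifolds.Rasmussen
import Literature.Topology.FourManifolds.RasmussenProofs
import Literature.Topology.FourManifolds.DehnSurgeryProofs

/-!
# Every hypothesis of `ZseSVanishesOnPairs` is load-bearing (negative lemmas for crux stmt-SmoothPoincare4-0368)

Crux `ZeroSurgeryExotic.ZseSVanishesOnPairs` (item `stmt-SmoothPoincare4-0368`; ledger signature
`∀ (K K' : Knot) (Y : Type) [TopologicalSpace Y] [ChartedSpace (𝔼 3) Y] (s : ℤ),
IsIntegralSurgery (𝓡 3) Y K 0 → IsIntegralSurgery (𝓡 3) Y K' 0 → K.IsSmoothlySlice →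
K'.HasRasmussenInvariant s → s = 0` — on a `0`-surgery pair with `K` smoothly slice Rasmussen's
`s(K')` vanishes) has four hypotheses.  This file proves, UNCONDITIONALLY, that dropping any one of
them (or the link between `K` and `K'`) makes the statement false, with honest witnesses from the
tree: the standard `unknot` (smoothly slice, `isSmoothlySlice_unknot`), the positive trefoil
`torusKnot 2 3` whose Rasmussen invariant `s = 2` is PROVED in the tree
(`hasRasmussenInvariant_torusKnot_holds`, computed from Lee's complex of its standard diagram), and
the existence of `0`-surgery on every knot (`exists_isIntegralSurgery_holds`).  Refuter negative
lemmas (cdisprove gen 1), supporting the crux item; each statement is the crux with one hypothesis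
deleted, spelled out (no new definitions).
-/

noncomputable section

set_option linter.dupNamespace false

open scoped Manifold ContDiff
open Literature.Topology.FourManifolds

namespace Summit.SmoothPoincare4.SmoothPoincare4.Theorems.ZseSVanishesOnPairs.Negative

/-- `s(T(2,3)) = 2` for the tree's positive trefoil `torusKnot 2 3` (instance of the PROVED
`hasRasmussenInvariant_torusKnot_holds`). [cite: Rasmussen2010, Thm. 4] -/
theorem hasRasmussenInvariant_trefoil_two :
    (torusKnot 2 3 le_rfl (by norm_num) (by decide)).HasRasmussenInvariant 2 := by
  have h := hasRasmussenInvariant_torusKnot_holds 2 3 le_rfl (by norm_num) (by decide)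
  norm_num at h
  exact h

/-- **`K.IsSmoothlySlice` is load-bearing**: the crux with the sliceness hypothesis deleted is
false — `K = K' = T(2,3)`, `Y = S³₀(T(2,3))`, `s = 2`. [cite: Rasmussen2010, Thm. 4] -/
theorem zseSVanishesOnPairs_false_without_slice :
    ¬ ∀ (K K' : Knot) (Y : Type) [TopologicalSpace Y] [ChartedSpace (EuclideanSpace ℝ (Fin 3)) Y]
        (s : ℤ), IsIntegralSurgery (𝓡 3) Y K 0 → IsIntegralSurgery (𝓡 3) Y K' 0 →
        K'.HasRasmussenInvariant s → s = 0 := by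
  intro h
  obtain ⟨Y, _, _, _, _, _, _, hY⟩ :=
    exists_isIntegralSurgery_holds (torusKnot 2 3 le_rfl (by norm_num) (by decide)) 0
  exact two_ne_zero (h _ _ Y 2 hY hY hasRasmussenInvariant_trefoil_two)

/-- **`K'.HasRasmussenInvariant s` is load-bearing** (and the remaining hypotheses are jointly
satisfiable, so the crux is not vacuous): `K = K' =` unknot, `Y = S³₀(U)`, `s = 1`. [folklore] -/
theorem zseSVanishesOnPairs_false_without_invariant :
    ¬ ∀ (K K' : Knot) (Y : Type) [TopologicalSpace Y] [ChartedSpace (EuclideanSpace ℝ (Fin 3)) Y]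
        (s : ℤ), IsIntegralSurgery (𝓡 3) Y K 0 → IsIntegralSurgery (𝓡 3) Y K' 0 →
        K.IsSmoothlySlice → s = 0 := by
  intro h
  obtain ⟨Y, _, _, _, _, _, _, hY⟩ := exists_isIntegralSurgery_holds unknot 0
  exact one_ne_zero (h unknot unknot Y 1 hY hY isSmoothlySlice_unknot)

/-- **The common `0`-surgery is load-bearing**: with no relation between `K` and `K'` the
statement fails at `K =` unknot (slice), `K' = T(2,3)` (`s = 2`). [cite: Rasmussen2010, Thm. 4] -/
theorem zseSVanishesOnPairs_false_without_commonSurgery :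
    ¬ ∀ (K K' : Knot) (s : ℤ), K.IsSmoothlySlice → K'.HasRasmussenInvariant s → s = 0 :=
  fun h ↦ two_ne_zero (h unknot _ 2 isSmoothlySlice_unknot hasRasmussenInvariant_trefoil_two)

/-- **`K'`'s surgery hypothesis is load-bearing**: keeping only `IsIntegralSurgery Y K 0` the
statement fails at `K =` unknot, `Y = S³₀(U)`, `K' = T(2,3)`, `s = 2`. [cite: Rasmussen2010, Thm. 4] -/
theorem zseSVanishesOnPairs_false_without_surgeryRight :
    ¬ ∀ (K K' : Knot) (Y : Type) [TopologicalSpace Y] [ChartedSpace (EuclideanSpace ℝ (Fin 3)) Y]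
        (s : ℤ), IsIntegralSurgery (𝓡 3) Y K 0 → K.IsSmoothlySlice →
        K'.HasRasmussenInvariant s → s = 0 := by
  intro h
  obtain ⟨Y, _, _, _, _, _, _, hY⟩ := exists_isIntegralSurgery_holds unknot 0
  exact two_ne_zero (h unknot _ Y 2 hY isSmoothlySlice_unknot hasRasmussenInvariant_trefoil_two)

/-- **`K`'s surgery hypothesis is load-bearing**: keeping only `IsIntegralSurgery Y K' 0` the
statement fails at `K =` unknot, `K' = T(2,3)`, `Y = S³₀(T(2,3))`, `s = 2`. [cite: Rasmussen2010, Thm. 4] -/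
theorem zseSVanishesOnPairs_false_without_surgeryLeft :
    ¬ ∀ (K K' : Knot) (Y : Type) [TopologicalSpace Y] [ChartedSpace (EuclideanSpace ℝ (Fin 3)) Y]
        (s : ℤ), IsIntegralSurgery (𝓡 3) Y K' 0 → K.IsSmoothlySlice →
        K'.HasRasmussenInvariant s → s = 0 := by
  intro h
  obtain ⟨Y, _, _, _, _, _, _, hY⟩ :=
    exists_isIntegralSurgery_holds (torusKnot 2 3 le_rfl (by norm_num) (by decide)) 0
  exact two_ne_zero (h unknot _ Y 2 hY isSmoothlySlice_unknot hasRasmussenInvariant_trefoil_two)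

end Summit.SmoothPoincare4.SmoothPoincare4.Theorems.ZseSVanishesOnPairs.Negative
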